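import Summits.Ventures.LatticeQCDFlow.Scoring.ChainLagProductACov
import Summits.Ventures.LatticeQCDFlow.Scoring.ConstantKernelChain
import Summits.Ventures.LatticeQCDFlow.Scoring.DoeblinEnvelopeSharp

/-!
# BARTLETT's MATRIX FOR THE INDEPENDENT SAMPLER: along the i.i.d. chain (constant kernel, `ε = 1`),
# `Σ(s,t) = chainLagACov` is DIAGONAL — `Σ(0,0) = Var_π(f̄²)`, `Σ(t,t) = (Var_π f)²` for `t ≥ 1`,
# `Σ(s,t) = 0` for `s ≠ t`

HONEST FRAMING: exact (Metropolis-corrected) sampling algorithms for lattice gauge theory;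
figures of merit are autocorrelation/cost numbers at stated couplings and volumes; no
continuum-physics claim.

Venture `LatticeQCDFlow` (cell pub-lqcd), sub-topic `Scoring`; FANOUT row 16 (`su2-base`), GEN-10.
NEW WORK of the cell, not a published result; no definition is introduced; nothing is cited as a fact
(Bartlett's formula for white noise, `Var ρ̂(t) ≈ 1/N` — Bartlett 1946, Anderson 1971 §8.4 — NAMED ONLY).
THE CALIBRATION INSTANCE of GEN-9/GEN-10's law-of-the-error packet: the INDEPENDENT sampler
(`κ = Kernel.const S π`, row 8's `ε = 1` chain, `Scoring/ConstantKernelChain`: its path law is the i.i.d.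
product law) is a chain with a Doeblin power (`m = 1`, `ε = 1`, `ν = π`), so every theorem of the packet
applies to it; here its Bartlett matrix `Σ = chainLagACov (const π) π f̄ W` (GEN-9
`Scoring/ChainLagProductACov`) is COMPUTED: all the `k ≥ 1` cross terms vanish (a coordinate outside a
finite index set is independent of the coordinates in it), and the `k = 0` term is `Var_π(f̄²)` at
`(0,0)`, `(Var_π f)²` on the rest of the diagonal and `0` off it.  The next file
(`Scoring/ChainTauIntWhiteNoise`) reads off `σ²_ℓ = W` — non-vacuity of the packet's hypothesis
`σ²_ℓ > 0` — and the calibration number `ρ = 1 + 1/(2W)` of the printed Madras–Sokal bar for white noise.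

## Content (`π` a probability law on `S`; `g` measurable, `|g| ≤ C`, `∫ g dπ = 0` — e.g. `g = f̄`;
## `v = ∫ g² dπ`; `P = P_{π, const π}` the i.i.d. path law)

* `constKernel_eq_lazy`, `invariant_constKernel`, `minorised_constKernel` (`1 • π ≤ nHit (const π) 1 z`),
  `autocov_constKernel` (`C(t) = v · 1{t = 0}`) — row 8's lazy-kernel algebra at `ε = 1`;
* `iid_integral_coord` (`∫ A(x_i) dP = ∫ A dπ`), **`iid_integral_mul_of_not_mem`** — for `i ∉ T`:
  `∫ A(x_i) · B((x_j)_{j∈T}) dP = (∫ A dπ) · ∫ B((x_j)_{j∈T}) dP` (Mathlib's `iIndepFun.indepFun_finset`);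
* `iid_lagProd_crossTerm_eq_zero` — every `k ≥ 1` term of `Σ(s,t)` vanishes;
  `iid_lagProd_zeroTerm` — the `k = 0` term;
* **`chainLagACov_constKernel`** — `Σ(s,t) = if s = t then (if s = 0 then ∫ (g² − v)² dπ else v²) else 0`.

NOT CLAIMED: non-constant kernels (the lazy kernel `ε < 1` has a non-diagonal `Σ`); unbounded `g`.
-/

noncomputable section

open MeasureTheory ProbabilityTheory Filter Finset Preorder
open scoped ENNReal NNReal Topology
open Summit.Ventures.LatticeQCDFlow.Exactness Summit.Ventures.LatticeQCDFlow.Exactness.GeneralNCMC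

namespace Summit.Ventures.LatticeQCDFlow.Scoring

variable {S : Type*} [MeasurableSpace S] (π : Measure S) [IsProbabilityMeasure π]

/-! ## The constant kernel: row 8's lazy kernel at `ε = 1` -/

section Const

omit [IsProbabilityMeasure π] in
/-- The constant kernel is the lazy kernel `ε π + (1 − ε) δ` with `ε = 1`. -/
theorem constKernel_eq_lazy (x : S) :
    Kernel.const S π x = (1 : ℝ≥0∞) • π + ((1 : ℝ≥0∞) - 1) • Measure.dirac x := by
  rw [Kernel.const_apply, one_smul, tsub_self, zero_smul, add_zero]

/-- `π` is invariant for the constant kernel `const π`. -/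
theorem invariant_constKernel : Kernel.Invariant (Kernel.const S π) π :=
  lazy_invariant (constKernel_eq_lazy π) le_rfl

omit [IsProbabilityMeasure π] in
/-- The constant kernel has the (one-step) Doeblin minorisation with `ε = 1`, `ν = π`. -/
theorem minorised_constKernel (z : S) : (1 : ℝ≥0∞) • π ≤ nHit (Kernel.const S π) 1 z := by
  rw [nHit_one, Kernel.const_apply, one_smul]

/-- **White-noise autocovariances**: for a `π`-centred bounded `g`, `C(0) = ∫ g² dπ` and `C(t) = 0` for
`t ≥ 1` along the constant-kernel chain. -/
theorem autocov_constKernel {g : S → ℝ} (hg : Measurable g) {C : ℝ} (hC : ∀ z, |g z| ≤ C)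
    (hg0 : ∫ z, g z ∂π = 0) (t : ℕ) :
    autocov (Kernel.const S π) π g t = if t = 0 then ∫ z, g z ^ 2 ∂π else 0 := by
  rw [lazy_autocov (constKernel_eq_lazy π) le_rfl hg hC hg0 t, ENNReal.toReal_one, sub_self]
  split_ifs with h
  · rw [h, pow_zero, one_mul]
  · rw [zero_pow h, zero_mul]

end Const

/-! ## Integrals against the i.i.d. path law -/

section IID

/-- **Single-coordinate integrals**: `∫ A(x_i) dP_{π, const π} = ∫ A dπ`. -/
theorem iid_integral_coord {A : S → ℝ} (hA : Measurable A) (i : ℕ) :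
    ∫ x, A (x i) ∂(Kernel.trajMeasure (X := fun _ : ℕ => S) π
        (fun n : ℕ => (Kernel.const S π).comap (fun hh : (j : ↥(Finset.Iic n)) → S =>
          hh ⟨n, Finset.mem_Iic.2 le_rfl⟩) (measurable_pi_apply _)))
      = ∫ z, A z ∂π := by
  have hmap : (Kernel.trajMeasure (X := fun _ : ℕ => S) π
      (fun n : ℕ => (Kernel.const S π).comap (fun hh : (j : ↥(Finset.Iic n)) → S =>
        hh ⟨n, Finset.mem_Iic.2 le_rfl⟩) (measurable_pi_apply _))).map (fun x : ℕ → S => x i) = π := by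
    rw [chain_const_iid, Measure.infinitePi_map_eval]
  calc ∫ x, A (x i) ∂(Kernel.trajMeasure (X := fun _ : ℕ => S) π
        (fun n : ℕ => (Kernel.const S π).comap (fun hh : (j : ↥(Finset.Iic n)) → S =>
          hh ⟨n, Finset.mem_Iic.2 le_rfl⟩) (measurable_pi_apply _)))
      = ∫ z, A z ∂((Kernel.trajMeasure (X := fun _ : ℕ => S) π
        (fun n : ℕ => (Kernel.const S π).comap (fun hh : (j : ↥(Finset.Iic n)) → S =>
          hh ⟨n, Finset.mem_Iic.2 le_rfl⟩) (measurable_pi_apply _))).map (fun x : ℕ → S => x i)) :=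
        (integral_map (measurable_pi_apply i).aemeasurable hA.aestronglyMeasurable).symm
    _ = ∫ z, A z ∂π := by rw [hmap]

/-- **A coordinate outside a finite index set is independent of the coordinates in it**: for `i ∉ T`,
measurable `A : S → ℝ` and `B : (T → S) → ℝ`,
`∫ A(x_i) · B((x_j)_{j∈T}) dP = (∫ A dπ) · ∫ B((x_j)_{j∈T}) dP` under the i.i.d. path law. -/
theorem iid_integral_mul_of_not_mem {i : ℕ} {T : Finset ℕ} (hi : i ∉ T)
    {A : S → ℝ} (hA : Measurable A) {B : (↥T → S) → ℝ} (hB : Measurable B) :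
    ∫ x, A (x i) * B (fun j : ↥T => x j) ∂(Kernel.trajMeasure (X := fun _ : ℕ => S) π
        (fun n : ℕ => (Kernel.const S π).comap (fun hh : (j : ↥(Finset.Iic n)) → S =>
          hh ⟨n, Finset.mem_Iic.2 le_rfl⟩) (measurable_pi_apply _)))
      = (∫ z, A z ∂π) * ∫ x, B (fun j : ↥T => x j) ∂(Kernel.trajMeasure (X := fun _ : ℕ => S) π
        (fun n : ℕ => (Kernel.const S π).comap (fun hh : (j : ↥(Finset.Iic n)) → S =>
          hh ⟨n, Finset.mem_Iic.2 le_rfl⟩) (measurable_pi_apply _))) := by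
  set P := Kernel.trajMeasure (X := fun _ : ℕ => S) π
    (fun n : ℕ => (Kernel.const S π).comap (fun hh : (j : ↥(Finset.Iic n)) → S =>
      hh ⟨n, Finset.mem_Iic.2 le_rfl⟩) (measurable_pi_apply _)) with hP
  have hind : iIndepFun (fun (n : ℕ) (x : ℕ → S) => x n) P := by
    rw [hP]; exact chain_const_iIndepFun π π
  have h2 : IndepFun (fun (x : ℕ → S) (j : (({i} : Finset ℕ) : Type)) => x j)
      (fun (x : ℕ → S) (j : ↥T) => x j) P :=
    hind.indepFun_finset {i} T (Finset.disjoint_singleton_left.2 hi) (fun n => measurable_pi_apply n)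
  have h3 : IndepFun (fun x : ℕ → S => A (x i)) (fun x : ℕ → S => B (fun j : ↥T => x j)) P :=
    h2.comp (φ := fun w : (({i} : Finset ℕ) : Type) → S => A (w ⟨i, Finset.mem_singleton_self i⟩))
      (ψ := B) (hA.comp (measurable_pi_apply _)) hB
  have h4 := h3.integral_fun_mul_eq_mul_integral (hA.comp (measurable_pi_apply i)).aestronglyMeasurable
    (hB.comp (measurable_pi_lambda _ fun j => measurable_pi_apply (j : ℕ))).aestronglyMeasurable
  rw [h4, hP, iid_integral_coord π hA i]

variable {π}

/-- Measurability bookkeeping for products of `g` at window coordinates. -/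
theorem measurable_coordFun {T : Finset ℕ} {g : S → ℝ} (hg : Measurable g) (j : ↥T) :
    Measurable fun w : ↥T → S => g (w j) :=
  hg.comp (measurable_pi_apply j)

variable (π)

/-- **Every `k ≥ 1` cross term of `Σ(s,t)` vanishes for the independent sampler**:
`∫ (g(x_0) g(x_s) − C(s)) (g(x_{k+1}) g(x_{k+1+t}) − C(t)) dP = 0`. -/
theorem iid_lagProd_crossTerm_eq_zero {g : S → ℝ} (hg : Measurable g) {C : ℝ} (hC : ∀ z, |g z| ≤ C)
    (hg0 : ∫ z, g z ∂π = 0) (s t k : ℕ) :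
    ∫ x, (g (x 0) * g (x s) - autocov (Kernel.const S π) π g s)
        * (g (x (k + 1)) * g (x (k + 1 + t)) - autocov (Kernel.const S π) π g t)
      ∂(Kernel.trajMeasure (X := fun _ : ℕ => S) π
        (fun n : ℕ => (Kernel.const S π).comap (fun hh : (j : ↥(Finset.Iic n)) → S =>
          hh ⟨n, Finset.mem_Iic.2 le_rfl⟩) (measurable_pi_apply _))) = 0 := by
  set v := ∫ z, g z ^ 2 ∂π with hv
  set Ct := autocov (Kernel.const S π) π g t with hCt
  by_cases hs : s = 0
  · -- `s = 0`: factor `g(x_0)² − v`, whose `π`-mean vanishes, against the coordinates `k+1`, `k+1+t`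
    subst hs
    rw [autocov_constKernel π hg hC hg0 0, if_pos rfl]
    have key := iid_integral_mul_of_not_mem π (i := 0) (T := {k + 1, k + 1 + t})
      (by simp only [Finset.mem_insert, Finset.mem_singleton]; omega) (A := fun z => g z * g z - v) ((hg.mul hg).sub measurable_const)
      (B := fun w => g (w ⟨k + 1, by simp⟩) * g (w ⟨k + 1 + t, by simp⟩) - Ct)
      (((measurable_coordFun hg _).mul (measurable_coordFun hg _)).sub measurable_const)
    have hA0 : ∫ z, g z * g z - v ∂π = 0 := by
      have hgg : Integrable (fun z => g z * g z) π :=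
        integrable_of_bounded π (hg.mul hg) (C := C * C) fun z => by
          rw [abs_mul]; exact mul_le_mul (hC z) (hC z) (abs_nonneg _) ((abs_nonneg _).trans (hC z))
      rw [integral_sub hgg (integrable_const v), integral_const, probReal_univ, one_smul, hv]
      simp_rw [pow_two]; ring
    rw [hA0, zero_mul] at key
    rw [← key]
  · -- `s ≥ 1`: `C(s) = 0`; factor `g(x_0)`, whose `π`-mean vanishes
    rw [autocov_constKernel π hg hC hg0 s, if_neg hs]
    simp only [sub_zero]
    have key := iid_integral_mul_of_not_mem π (i := 0) (T := {s, k + 1, k + 1 + t})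
      (by simp only [Finset.mem_insert, Finset.mem_singleton]; omega) (A := g) hg
      (B := fun w => g (w ⟨s, by simp⟩) * (g (w ⟨k + 1, by simp⟩) * g (w ⟨k + 1 + t, by simp⟩) - Ct))
      ((measurable_coordFun hg _).mul
        (((measurable_coordFun hg _).mul (measurable_coordFun hg _)).sub measurable_const))
    rw [hg0, zero_mul] at key
    rw [← key]
    exact integral_congr_ae (ae_of_all _ fun x => by ring)

/-- **The `k = 0` term of `Σ(s,t)` for the independent sampler**:
`∫ (g(x_0) g(x_s) − C(s)) (g(x_0) g(x_t) − C(t)) dP` is `∫ (g² − v)² dπ` for `s = t = 0`, `v²` for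
`s = t ≥ 1`, and `0` for `s ≠ t`. -/
theorem iid_lagProd_zeroTerm {g : S → ℝ} (hg : Measurable g) {C : ℝ} (hC : ∀ z, |g z| ≤ C)
    (hg0 : ∫ z, g z ∂π = 0) (s t : ℕ) :
    ∫ x, (g (x 0) * g (x s) - autocov (Kernel.const S π) π g s)
        * (g (x 0) * g (x t) - autocov (Kernel.const S π) π g t)
      ∂(Kernel.trajMeasure (X := fun _ : ℕ => S) π
        (fun n : ℕ => (Kernel.const S π).comap (fun hh : (j : ↥(Finset.Iic n)) → S =>
          hh ⟨n, Finset.mem_Iic.2 le_rfl⟩) (measurable_pi_apply _)))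
      = if s = t then (if s = 0 then ∫ z, (g z ^ 2 - ∫ z', g z' ^ 2 ∂π) ^ 2 ∂π
          else (∫ z, g z ^ 2 ∂π) ^ 2) else 0 := by
  set v := ∫ z, g z ^ 2 ∂π with hv
  rw [autocov_constKernel π hg hC hg0 s, autocov_constKernel π hg hC hg0 t]
  by_cases hs : s = 0
  · subst hs
    by_cases ht : (0 : ℕ) = t
    · -- `s = t = 0`: a single-coordinate integral, `∫ (g² − v)² dπ`
      subst ht
      simp only [if_true]
      rw [← iid_integral_coord π (A := fun z => (g z ^ 2 - v) ^ 2)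
        (((hg.pow_const 2).sub measurable_const).pow_const 2) 0]
      exact integral_congr_ae (ae_of_all _ fun x => by ring)
    · -- `s = 0`, `t ≥ 1`: factor `g(x_t)`
      rw [if_neg ht, if_pos rfl, if_neg (Ne.symm ht)]
      simp only [sub_zero]
      have key := iid_integral_mul_of_not_mem π (i := t) (T := {0})
        (by simp only [Finset.mem_singleton]; omega) (A := g) hg
        (B := fun w => (g (w ⟨0, by simp⟩) * g (w ⟨0, by simp⟩) - v) * g (w ⟨0, by simp⟩))
        ((((measurable_coordFun hg _).mul (measurable_coordFun hg _)).sub measurable_const).mul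
          (measurable_coordFun hg _))
      rw [hg0, zero_mul] at key
      rw [← key]
      exact integral_congr_ae (ae_of_all _ fun x => by ring)
  · by_cases ht : t = 0
    · -- `s ≥ 1`, `t = 0`: factor `g(x_s)`
      subst ht
      rw [if_neg hs, if_neg hs, if_pos rfl]
      simp only [sub_zero]
      have key := iid_integral_mul_of_not_mem π (i := s) (T := {0})
        (by simp only [Finset.mem_singleton]; omega) (A := g) hg
        (B := fun w => g (w ⟨0, by simp⟩) * (g (w ⟨0, by simp⟩) * g (w ⟨0, by simp⟩) - v))
        ((measurable_coordFun hg _).mul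
          (((measurable_coordFun hg _).mul (measurable_coordFun hg _)).sub measurable_const))
      rw [hg0, zero_mul] at key
      rw [← key]
      exact integral_congr_ae (ae_of_all _ fun x => by ring)
    · rw [if_neg hs, if_neg ht]
      simp only [sub_zero]
      by_cases hst : s = t
      · -- `s = t ≥ 1`: `E[g(x_0)² g(x_s)²] = v · v`
        subst hst
        rw [if_pos rfl, if_neg hs]
        have key := iid_integral_mul_of_not_mem π (i := s) (T := {0})
          (by simp only [Finset.mem_singleton]; omega) (A := fun z => g z ^ 2) (hg.pow_const 2)
          (B := fun w => g (w ⟨0, by simp⟩) ^ 2) ((measurable_coordFun hg _).pow_const 2)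
        have hB : ∫ x, (fun w : ↥({0} : Finset ℕ) → S => g (w ⟨0, by simp⟩) ^ 2) (fun j => x j)
            ∂(Kernel.trajMeasure (X := fun _ : ℕ => S) π
              (fun n : ℕ => (Kernel.const S π).comap (fun hh : (j : ↥(Finset.Iic n)) → S =>
                hh ⟨n, Finset.mem_Iic.2 le_rfl⟩) (measurable_pi_apply _))) = v :=
          iid_integral_coord π (A := fun z => g z ^ 2) (hg.pow_const 2) 0
        rw [hB, ← hv, ← pow_two] at key
        rw [← key]
        exact integral_congr_ae (ae_of_all _ fun x => by ring)
      · -- `s ≠ t`, both `≥ 1`: factor `g(x_t)`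
        rw [if_neg hst]
        have key := iid_integral_mul_of_not_mem π (i := t) (T := {0, s})
          (by simp only [Finset.mem_insert, Finset.mem_singleton]; omega) (A := g) hg
          (B := fun w => g (w ⟨0, by simp⟩) * g (w ⟨s, by simp⟩) * g (w ⟨0, by simp⟩))
          (((measurable_coordFun hg _).mul (measurable_coordFun hg _)).mul (measurable_coordFun hg _))
        rw [hg0, zero_mul] at key
        rw [← key]
        exact integral_congr_ae (ae_of_all _ fun x => by ring)

/-- **BARTLETT's MATRIX OF THE INDEPENDENT SAMPLER IS DIAGONAL**: for a `π`-centred bounded `g` and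
every window `W`, `chainLagACov (const π) π g W s t = if s = t then (if s = 0 then ∫ (g² − v)² dπ else v²)
else 0`, `v = ∫ g² dπ`. -/
theorem chainLagACov_constKernel (W : ℕ) {g : S → ℝ} (hg : Measurable g) {C : ℝ} (hC : ∀ z, |g z| ≤ C)
    (hg0 : ∫ z, g z ∂π = 0) (s t : Fin (W + 1)) :
    chainLagACov (Kernel.const S π) π g W s t
      = if s = t then (if (s : ℕ) = 0 then ∫ z, (g z ^ 2 - ∫ z', g z' ^ 2 ∂π) ^ 2 ∂π
          else (∫ z, g z ^ 2 ∂π) ^ 2) else 0 := by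
  unfold chainLagACov
  simp only [windowPath_apply, Fin.val_zero, add_zero, zero_add]
  have hK : ∀ k : ℕ, (∫ x, (g (x 0) * g (x s) - autocov (Kernel.const S π) π g s)
        * (g (x (k + 1)) * g (x (k + 1 + t)) - autocov (Kernel.const S π) π g t)
      ∂(Kernel.trajMeasure (X := fun _ : ℕ => S) π
        (fun n : ℕ => (Kernel.const S π).comap (fun hh : (j : ↥(Finset.Iic n)) → S =>
          hh ⟨n, Finset.mem_Iic.2 le_rfl⟩) (measurable_pi_apply _))))
      + ∫ x, (g (x 0) * g (x t) - autocov (Kernel.const S π) π g t)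
        * (g (x (k + 1)) * g (x (k + 1 + s)) - autocov (Kernel.const S π) π g s)
      ∂(Kernel.trajMeasure (X := fun _ : ℕ => S) π
        (fun n : ℕ => (Kernel.const S π).comap (fun hh : (j : ↥(Finset.Iic n)) → S =>
          hh ⟨n, Finset.mem_Iic.2 le_rfl⟩) (measurable_pi_apply _))) = 0 := fun k => by
    rw [iid_lagProd_crossTerm_eq_zero π hg hC hg0 s t k, iid_lagProd_crossTerm_eq_zero π hg hC hg0 t s k,
      add_zero]
  simp only [hK, tsum_zero, add_zero]
  rw [iid_lagProd_zeroTerm π hg hC hg0 s t]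
  simp only [Fin.ext_iff]

end IID

end Summit.Ventures.LatticeQCDFlow.Scoring

end
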